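import Summits.Langlands.Langlands.Theorems.PhantomRMYoshidaResiduallyYoshidaLiftingSplit
import HarnessLib

/-!
# Route `PhantomRMYoshida`, crux `ResiduallyYoshidaLifting` (stmt-Langlands-13639), line
# `sector-klingen-split`: the propagation stub R1d `stub_nonsplitPropagation` measured against the route target

Stub-worker of lead prover-line-stmt-Langlands-13639-c3-0 (2026-08-17), registered sub-goal
`stub_nonsplitPropagation_of_target` (`--supports stmt-Langlands-13639`).

The registered stub R1d `stub_nonsplitPropagation` of the checked skeleton
`Cruxes/ResiduallyYoshidaLifting/Lines/sector_klingen_split.lean` (rev 4) — "on a generic admissible fibre, an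
irreducible `Sh`-point `ρ` realising a NON-trivial residual class `[B]` that is also realised by an AUTOMORPHIC
irreducible point `ρ₁` of the ordinary family (any weight `≡ (0,0,1,1) mod (p-1)`) is a Klingen classical limit"
— is the `GSp₄` transplant of Skinner–Wiles nice-prime patching / pro-modularity propagation on
`Spec R^{ord}(ρ̄_B)` for the NON-SPLIT residual representation `ρ̄_B = (σ̄, B; 0, σ̄')`, OPEN IN PRINT
(strategist census §3 F3, §7 R1(d)).  This file records, kernel-checked, that it carries NO risk beyond the
route's own target `PhantomRMSector`: under the target the irreducible `Sh`-point `ρ` is itself automorphic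
(oddness of `σ̄, σ̄'` from `DetC` via `isOdd_of_detC`; `DetC`/`Sh`/`Aut` are definitionally the target's
inline clauses), hence its own Klingen approximant at every depth (`isKlingenClassicalLimit_of_aut`, p116982:
`r' := ρ`, `c := 1`, equal Frobenius polynomials) — packaged as `klingenDensityGeneric_of_phantomRMSector`
(p137929).  The cocycle `B`, its non-triviality, the realisation frame of `ρ` and the automorphic anchor `ρ₁`
are not consumed.  Nothing is asserted: the target enters only as a hypothesis.
-/

noncomputable section

-- `Summit.Langlands.Langlands.…` (summit = sub-problem name, D-0017 layout) trips `dupNamespace` on every decl.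
set_option linter.dupNamespace false
set_option autoImplicit false

open IsDedekindDomain Filter
open Literature.NumberTheory.GaloisRepresentations Literature.NumberTheory.Automorphic
open Summit.Langlands.Langlands.Cruxes.ResiduallyYoshidaLifting.YoshidaDivisorSelmerCount
open Summit.Langlands.Langlands.Cruxes.ResiduallyYoshidaLifting.SectorSplit

namespace Summit.Langlands.Langlands.Cruxes.ResiduallyYoshidaLifting.SectorKlingenSplit

/-- **R1d ≤ route target** (registered sub-goal `stub_nonsplitPropagation_of_target`): the route target
`PhantomRMSector` implies the registered propagation statement `stub_nonsplitPropagation` verbatim.  The target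
gives `KlingenDensityGeneric` (`klingenDensityGeneric_of_phantomRMSector`, p137929: an automorphic `Sh`-point is
its own Klingen approximant, `isKlingenClassicalLimit_of_aut`, oddness from `DetC`), whose hypotheses are among
those of R1d; the cocycle `B`, the realisation frame `(P, rint, h)` of `ρ` and the anchor `ρ₁` are unused. -/
theorem stub_nonsplitPropagation_of_target :
    Summit.Langlands.Langlands.Theses.PhantomRMYoshida.PhantomRMSector → (∀ (p : ℕ) [Fact p.Prime], p ≠ 2 →
    ∀ (k : Type) [Field k] [CharP k p] [IsAlgClosed k]
    [TopologicalSpace k] [DiscreteTopology k] (red : Valued.integer (PadicAlgCl p) →+* k)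
    (σ σ' : FramedGaloisRep ℚ k 2) (hcpt : isCompact_glFiniteIntegralLevel 4 ℚ) (ι : PadicAlgCl p ≃+* ℂ)
    (ρ : FramedGaloisRep ℚ (PadicAlgCl p) 4) (B : Field.absoluteGaloisGroup ℚ → Matrix (Fin 2) (Fin 2) k),
    σ.toGaloisRep.IsIrreducible → σ'.toGaloisRep.IsIrreducible → DetC p k σ σ' →
    (¬ ∃ g : GL (Fin 2) k, ∀ x, g * σ x * g⁻¹ = σ' x) → GenericSector p k σ σ' →
    (¬ ∃ X : Matrix (Fin 2) (Fin 2) k, ∀ g, B g = (σ g).val * X - X * (σ' g).val) →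
    ρ.toGaloisRep.IsIrreducible → Sh p k red σ σ' ρ →
    (∃ (P : GL (Fin 4) (PadicAlgCl p))
        (rint : Field.absoluteGaloisGroup ℚ →* GL (Fin 4) (Valued.integer (PadicAlgCl p))) (h : GL (Fin 4) k),
        (∀ g, Matrix.GeneralLinearGroup.map (Valued.integer (PadicAlgCl p)).subtype (rint g) = P⁻¹ * ρ g * P) ∧
        (∀ g, (Matrix.GeneralLinearGroup.map red (rint g)).val =
          h.val * Matrix.reindex finSumFinEquiv finSumFinEquiv
            (Matrix.fromBlocks (σ g).val (B g) 0 (σ' g).val) * (h⁻¹).val)) →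
    (∃ ρ₁ : FramedGaloisRep ℚ (PadicAlgCl p) 4, ρ₁.toGaloisRep.IsIrreducible ∧ Aut p hcpt ι ρ₁ ∧
      (∃ a : Fin 4 → ℕ, a 0 = 0 ∧ (a 1 : ZMod (p - 1)) = 0 ∧ (a 2 : ZMod (p - 1)) = 1 ∧ (a 3 : ZMod (p - 1)) = 1 ∧
        (∃ ν : Field.absoluteGaloisGroup ℚ → PadicAlgCl p, ρ₁.IsSymplecticWithMultiplierFun ν) ∧
        ∀ v : HeightOneSpectrum (NumberField.RingOfIntegers ℚ), ((p : ℕ) : NumberField.RingOfIntegers ℚ) ∈ v.asIdeal →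
          ρ₁.IsGreenbergOrdinaryOfShapeAt v a ∧ ρ₁.IsResiduallyDistinguishedAt v a) ∧
      ∃ (P : GL (Fin 4) (PadicAlgCl p))
        (rint : Field.absoluteGaloisGroup ℚ →* GL (Fin 4) (Valued.integer (PadicAlgCl p))) (h : GL (Fin 4) k),
        (∀ g, Matrix.GeneralLinearGroup.map (Valued.integer (PadicAlgCl p)).subtype (rint g) = P⁻¹ * ρ₁ g * P) ∧
        (∀ g, (Matrix.GeneralLinearGroup.map red (rint g)).val =
          h.val * Matrix.reindex finSumFinEquiv finSumFinEquiv
            (Matrix.fromBlocks (σ g).val (B g) 0 (σ' g).val) * (h⁻¹).val)) →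
    IsKlingenClassicalLimit p hcpt ι ρ) :=
  fun hT p _ hp k _ _ _ _ _ red σ σ' hcpt ι ρ _B hσ hσ' hdet hnc hG _hncB hρ hSh _hreal _hanchor =>
    klingenDensityGeneric_of_phantomRMSector hT p hp k red σ σ' hcpt ι ρ hσ hσ' hdet hnc hG hρ hSh

/-- Unfolded form of the same implication (a direct check that the proof is the intended one: the target's
`Aut ρ`, with oddness supplied by `isOdd_of_detC`, fed to `isKlingenClassicalLimit_of_aut`). -/
example (hT : Summit.Langlands.Langlands.Theses.PhantomRMYoshida.PhantomRMSector) (p : ℕ) [Fact p.Prime]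
    (hp : p ≠ 2) (k : Type) [Field k] [CharP k p] [IsAlgClosed k] [TopologicalSpace k] [DiscreteTopology k]
    (red : Valued.integer (PadicAlgCl p) →+* k) (σ σ' : FramedGaloisRep ℚ k 2)
    (hcpt : isCompact_glFiniteIntegralLevel 4 ℚ) (ι : PadicAlgCl p ≃+* ℂ) (ρ : FramedGaloisRep ℚ (PadicAlgCl p) 4)
    (hσ : σ.toGaloisRep.IsIrreducible) (hσ' : σ'.toGaloisRep.IsIrreducible) (hdet : DetC p k σ σ')
    (hnc : ¬ ∃ g : GL (Fin 2) k, ∀ x, g * σ x * g⁻¹ = σ' x) (hρ : ρ.toGaloisRep.IsIrreducible)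
    (hSh : Sh p k red σ σ' ρ) : IsKlingenClassicalLimit p hcpt ι ρ :=
  isKlingenClassicalLimit_of_aut hSh
    (hT p hp k red σ σ' hcpt ι ρ (isOdd_of_detC hdet).1 (isOdd_of_detC hdet).2 hσ hσ' hdet hnc hρ hSh)

end Summit.Langlands.Langlands.Cruxes.ResiduallyYoshidaLifting.SectorKlingenSplit

end
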